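import Mathlib
import Summits.MatrixMultiplication.MatrixMultiplication.Theses.SnSubsetDichotomy

/-!
# Gadget planting (kit) — crux `JuntaBranch` (stmt-MatrixMultiplication-8304), analysis of line
`mover-covering-amgm`

PLANTING. A TPP triple `(S,T,U)` of `S_n` and a TPP "gadget" `(A,B,C)` of `S_m` give the TPP
triple `(S × A, T × B, U × C)` of `S_n × S_m ↪ S_{n+m}` (block-diagonal permutations), of volume
`|S||T||U|·|A||B||C|`. With `m = 2` and the gadget `({1}, {1, (0 1)}, {1})`: the volume doubles,
`Large(c')` at level `n` becomes `Large(c)` at level `n + 2` for every `c > c'` (the loss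
`((n+1)(n+2))^{3/2} < e^{(c-c')√n}/2` eventually), an `ε`-super-neutral block `(I → L)` of `S`
extended by the two fresh points (sent to themselves) stays `ε`-super-neutral
(`(n+2)^{(t+2)} = (n+2)(n+1)·n^{(t)}` against `(n+2)^{(1/2+ε)(t+2)} ≤ e²(n+2)^{1+2ε}·n^{(1/2+ε)t}`),
inclusion-saturating the two partners only ADDS elements, and the planted middle set
`T × {1, (0 1)}` contains two permutations sending the fresh source `0` to the two fresh targets
`0` and `1` of the extended block — so its source supports on that block are NOT disjoint.

This file is the KIT (TPP transport along injective homomorphisms and products, the `S_2` gadget,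
and the two real-analytic thresholds of the planting step); the consequence is drawn in
`SnSubsetDichotomyJuntaBranchPlantingSelfDefeat.lean`:

CONSEQUENCE (`Planting.partnersDisjointOnBand_selfDefeating`). The registered stub
`stub_partnersDisjointOnBand` of line `mover-covering-amgm` (hypothesis `hstub`, verbatim) says
that in a Large(`c`) TPP triple with inclusion-saturated partners, at an `ε`-super-neutral block of
`S` whose size lies in the band `[2n^{(1-ε)/2}, c√n/(ε ln n + 2)]`, both partners have pairwise
disjoint source supports. Planting shows that this conclusion is destroyed at polynomial volume
cost while every hypothesis is kept; hence the stub IMPLIES that its own hypothesis is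
(essentially) never met: for every `c' < c`, eventually NO Large(`c'`) TPP triple of `S_n` has an
`ε`-super-neutral `S`-block `(I → L)` of any size `t` with `t + 2` in the level-`(n+2)` band. So the
stub can hold only vacuously (outside the volume shell `e^{-c√n} ≤ V/(n!)^{3/2} < e^{-c'√n}` and
the `O(1)` edges of the band), its disjointness conclusion never does any work, and the line's
AM–GM payment (`amgmAtom`, `windowGain`) never fires: the line's real content is band-bump-freeness
of near-threshold TPP triples, a GlobalBranch-type statement for which the line has no lever.

All statements are def-free (the crux's sub-formulas are inlined exactly as in the registered
stub signatures).
-/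

set_option linter.dupNamespace false

open Literature.Combinatorics.Additive
open scoped Classical

namespace Summit.MatrixMultiplication.MatrixMultiplication.Theorems.JuntaBranch.Planting

/-! ## TPP transport -/

/-- The triple product property is transported along an injective group homomorphism. -/
theorem tpp_image_of_injective {G H : Type*} [Group G] [Group H] [DecidableEq H]
    (f : G →* H) (hf : Function.Injective f) {S T U : Finset G}
    (h : TripleProductProperty S T U) :
    TripleProductProperty (S.image f) (T.image f) (U.image f) := by
  intro s hs s' hs' t ht t' ht' u hu u' hu' hprod
  simp only [Finset.mem_image] at hs hs' ht ht' hu hu'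
  obtain ⟨s, hs, rfl⟩ := hs
  obtain ⟨s', hs', rfl⟩ := hs'
  obtain ⟨t, ht, rfl⟩ := ht
  obtain ⟨t', ht', rfl⟩ := ht'
  obtain ⟨u, hu, rfl⟩ := hu
  obtain ⟨u', hu', rfl⟩ := hu'
  have h1 : f (s * s'⁻¹ * (t * t'⁻¹) * (u * u'⁻¹)) = f 1 := by
    simpa only [map_mul, map_inv, map_one] using hprod
  obtain ⟨e1, e2, e3⟩ := h s hs s' hs' t ht t' ht' u hu u' hu' (hf h1)
  exact ⟨congrArg f e1, congrArg f e2, congrArg f e3⟩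

/-- The triple product property of a product of two TPP triples (in the product group). -/
theorem tpp_product {G₁ G₂ : Type*} [Group G₁] [Group G₂] {S T U : Finset G₁}
    {A B C : Finset G₂} (h₁ : TripleProductProperty S T U) (h₂ : TripleProductProperty A B C) :
    TripleProductProperty (S ×ˢ A) (T ×ˢ B) (U ×ˢ C) := by
  intro s hs s' hs' t ht t' ht' u hu u' hu' hprod
  rw [Finset.mem_product] at hs hs' ht ht' hu hu'
  obtain ⟨e₁, e₂⟩ := Prod.ext_iff.mp hprod
  simp only [Prod.fst_mul, Prod.fst_inv, Prod.fst_one, Prod.snd_mul, Prod.snd_inv,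
    Prod.snd_one] at e₁ e₂
  obtain ⟨a1, a2, a3⟩ := h₁ _ hs.1 _ hs'.1 _ ht.1 _ ht'.1 _ hu.1 _ hu'.1 e₁
  obtain ⟨b1, b2, b3⟩ := h₂ _ hs.2 _ hs'.2 _ ht.2 _ ht'.2 _ hu.2 _ hu'.2 e₂
  exact ⟨Prod.ext a1 b1, Prod.ext a2 b2, Prod.ext a3 b3⟩

/-- The gadget `({1}, {1, (0 1)}, {1})` of `S_2` has the triple product property (trivially: the
outer sets are singletons). -/
theorem gadget_tpp :
    TripleProductProperty ({1} : Finset (Equiv.Perm (Fin 2)))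
      ({1, Equiv.swap 0 1} : Finset (Equiv.Perm (Fin 2))) ({1} : Finset (Equiv.Perm (Fin 2))) := by
  intro s hs s' hs' t ht t' ht' u hu u' hu' hprod
  rw [Finset.mem_singleton] at hs hs' hu hu'
  subst hs hs' hu hu'
  refine ⟨rfl, ?_, rfl⟩
  have h1 : t * t'⁻¹ = 1 := by simpa using hprod
  exact mul_inv_eq_one.mp h1

/-! ## Real arithmetic of the planting step -/

/-- VOLUME: planting two points costs `((n+1)(n+2))^{3/2} ≤ (n+2)^3`, which the slack
`e^{(c-c')√n}` absorbs: for `n` large, `((n+2)!)^{3/2} e^{-c√(n+2)} ≤ 2·(n!)^{3/2} e^{-c'√n}`. -/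
theorem large_planting_threshold {c c' : ℝ} (hc : 0 < c) (hc' : c' < c) :
    ∃ nL : ℕ, ∀ n ≥ nL,
      (((n + 2).factorial : ℕ) : ℝ) ^ ((3 : ℝ) / 2) * Real.exp (-(c * Real.sqrt ((n + 2 : ℕ) : ℝ))) ≤
        2 * ((n.factorial : ℝ) ^ ((3 : ℝ) / 2) * Real.exp (-(c' * Real.sqrt (n : ℝ)))) := by
  set δ : ℝ := c - c' with hδ
  have hδ0 : 0 < δ := by rw [hδ]; linarith
  refine ⟨⌈161280 / δ ^ 8⌉₊ + 2, fun n hn => ?_⟩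
  have hn2 : 2 ≤ n := le_trans (Nat.le_add_left 2 _) hn
  have hnδ : 161280 / δ ^ 8 ≤ (n : ℝ) := by
    have h1 : ⌈161280 / δ ^ 8⌉₊ ≤ n := le_trans (Nat.le_add_right _ 2) hn
    exact le_trans (Nat.le_ceil _) (by exact_mod_cast h1)
  have hn0 : (0 : ℝ) < n := by exact_mod_cast (lt_of_lt_of_le (by norm_num) hn2)
  have hF0 : (0 : ℝ) < (n.factorial : ℝ) := by exact_mod_cast n.factorial_pos
  -- (n+2)! = n! * ((n+1)(n+2))
  have hfac : (((n + 2).factorial : ℕ) : ℝ) = (n.factorial : ℝ) * (((n : ℝ) + 1) * ((n : ℝ) + 2)) := by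
    rw [Nat.factorial_succ, Nat.factorial_succ]
    push_cast
    ring
  have hP0 : (0 : ℝ) ≤ ((n : ℝ) + 1) * ((n : ℝ) + 2) := by positivity
  -- ((n+1)(n+2))^{3/2} ≤ (n+2)^3
  have hpoly : (((n : ℝ) + 1) * ((n : ℝ) + 2)) ^ ((3 : ℝ) / 2) ≤ ((n : ℝ) + 2) ^ 3 := by
    have h1 : ((n : ℝ) + 1) * ((n : ℝ) + 2) ≤ ((n : ℝ) + 2) ^ (2 : ℝ) := by
      rw [Real.rpow_two]
      nlinarith
    calc (((n : ℝ) + 1) * ((n : ℝ) + 2)) ^ ((3 : ℝ) / 2)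
        ≤ (((n : ℝ) + 2) ^ (2 : ℝ)) ^ ((3 : ℝ) / 2) :=
          Real.rpow_le_rpow hP0 h1 (by norm_num)
      _ = ((n : ℝ) + 2) ^ 3 := by
          rw [← Real.rpow_mul (by positivity),
            show (2 : ℝ) * ((3 : ℝ) / 2) = ((3 : ℕ) : ℝ) by norm_num, Real.rpow_natCast]
  -- exp(-c√(n+2)) ≤ exp(-c√n)
  have hexp : Real.exp (-(c * Real.sqrt ((n + 2 : ℕ) : ℝ))) ≤ Real.exp (-(c * Real.sqrt (n : ℝ))) := by
    rw [Real.exp_le_exp, neg_le_neg_iff]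
    apply mul_le_mul_of_nonneg_left _ hc.le
    apply Real.sqrt_le_sqrt
    push_cast
    linarith
  -- the slack: (n+2)^3 * exp(-c√n) ≤ 2 * exp(-c'√n)
  have hslack : ((n : ℝ) + 2) ^ 3 * Real.exp (-(c * Real.sqrt (n : ℝ))) ≤
      2 * Real.exp (-(c' * Real.sqrt (n : ℝ))) := by
    have hs0 : 0 ≤ Real.sqrt (n : ℝ) := Real.sqrt_nonneg _
    have hds : 0 ≤ δ * Real.sqrt (n : ℝ) := mul_nonneg hδ0.le hs0
    -- exp(δ√n) ≥ (δ√n)^8 / 8!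
    have h8 := Real.pow_div_factorial_le_exp (δ * Real.sqrt (n : ℝ)) hds 8
    have hsq : Real.sqrt (n : ℝ) ^ 8 = (n : ℝ) ^ 4 := by
      rw [show (8 : ℕ) = 2 * 4 by norm_num, pow_mul, Real.sq_sqrt hn0.le]
    have h8' : δ ^ 8 * (n : ℝ) ^ 4 / 40320 ≤ Real.exp (δ * Real.sqrt (n : ℝ)) := by
      have e : (δ * Real.sqrt (n : ℝ)) ^ 8 / (Nat.factorial 8 : ℝ) = δ ^ 8 * (n : ℝ) ^ 4 / 40320 := by
        rw [mul_pow, hsq]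
        norm_num [Nat.factorial]
      rw [← e]
      exact h8
    -- (n+2)^3 ≤ 8 n^3 ≤ δ^8 n^4 / 20160
    have hcube : ((n : ℝ) + 2) ^ 3 ≤ 8 * (n : ℝ) ^ 3 := by
      have h2 : (2 : ℝ) ≤ n := by exact_mod_cast hn2
      nlinarith [pow_le_pow_left₀ (by positivity : (0 : ℝ) ≤ (n : ℝ) + 2)
        (by linarith : (n : ℝ) + 2 ≤ 2 * n) 3]
    have hδ8 : 0 < δ ^ 8 := by positivity
    have hkey : 8 * (n : ℝ) ^ 3 ≤ 2 * (δ ^ 8 * (n : ℝ) ^ 4 / 40320) := by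
      have h1 : 161280 ≤ δ ^ 8 * (n : ℝ) := by
        have := (div_le_iff₀ hδ8).mp hnδ
        linarith
      have hn3 : 0 ≤ (n : ℝ) ^ 3 := by positivity
      nlinarith
    have hE : Real.exp (-(c' * Real.sqrt (n : ℝ))) =
        Real.exp (δ * Real.sqrt (n : ℝ)) * Real.exp (-(c * Real.sqrt (n : ℝ))) := by
      rw [← Real.exp_add, hδ]
      ring_nf
    rw [hE]
    have hx0 : 0 < Real.exp (-(c * Real.sqrt (n : ℝ))) := Real.exp_pos _
    calc ((n : ℝ) + 2) ^ 3 * Real.exp (-(c * Real.sqrt (n : ℝ)))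
        ≤ (2 * (δ ^ 8 * (n : ℝ) ^ 4 / 40320)) * Real.exp (-(c * Real.sqrt (n : ℝ))) :=
          mul_le_mul_of_nonneg_right (hcube.trans hkey) hx0.le
      _ ≤ (2 * Real.exp (δ * Real.sqrt (n : ℝ))) * Real.exp (-(c * Real.sqrt (n : ℝ))) := by
          gcongr
      _ = 2 * (Real.exp (δ * Real.sqrt (n : ℝ)) * Real.exp (-(c * Real.sqrt (n : ℝ)))) := by ring
  -- assemble
  have hF32 : 0 ≤ (n.factorial : ℝ) ^ ((3 : ℝ) / 2) := by positivity
  calc (((n + 2).factorial : ℕ) : ℝ) ^ ((3 : ℝ) / 2) * Real.exp (-(c * Real.sqrt ((n + 2 : ℕ) : ℝ)))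
      = (n.factorial : ℝ) ^ ((3 : ℝ) / 2) * ((((n : ℝ) + 1) * ((n : ℝ) + 2)) ^ ((3 : ℝ) / 2)) *
          Real.exp (-(c * Real.sqrt ((n + 2 : ℕ) : ℝ))) := by
        rw [hfac, Real.mul_rpow hF0.le hP0]
    _ ≤ (n.factorial : ℝ) ^ ((3 : ℝ) / 2) * ((n : ℝ) + 2) ^ 3 * Real.exp (-(c * Real.sqrt (n : ℝ))) := by
        gcongr
    _ = (n.factorial : ℝ) ^ ((3 : ℝ) / 2) * (((n : ℝ) + 2) ^ 3 * Real.exp (-(c * Real.sqrt (n : ℝ)))) := by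
        ring
    _ ≤ (n.factorial : ℝ) ^ ((3 : ℝ) / 2) * (2 * Real.exp (-(c' * Real.sqrt (n : ℝ)))) :=
        mul_le_mul_of_nonneg_left hslack hF32
    _ = 2 * ((n.factorial : ℝ) ^ ((3 : ℝ) / 2) * Real.exp (-(c' * Real.sqrt (n : ℝ)))) := by ring

/-- SHIFT OF THE BASE: `(n+2)^x ≤ e² · n^x` for `0 ≤ x ≤ n` (`(1 + 2/n)^x ≤ e^{2x/n} ≤ e²`). -/
theorem rpow_base_shift_le {n : ℕ} (hn : 0 < n) {x : ℝ} (hx0 : 0 ≤ x) (hxn : x ≤ n) :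
    ((n : ℝ) + 2) ^ x ≤ Real.exp 2 * (n : ℝ) ^ x := by
  have hn0 : (0 : ℝ) < n := by exact_mod_cast hn
  have hsplit : (n : ℝ) + 2 = (n : ℝ) * (1 + 2 / n) := by field_simp
  rw [hsplit, Real.mul_rpow hn0.le (by positivity)]
  have h1 : (1 + 2 / (n : ℝ)) ^ x ≤ Real.exp 2 := by
    have hb : 1 + 2 / (n : ℝ) ≤ Real.exp (2 / n) := by
      have := Real.add_one_le_exp (2 / (n : ℝ))
      linarith
    calc (1 + 2 / (n : ℝ)) ^ x ≤ (Real.exp (2 / n)) ^ x :=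
          Real.rpow_le_rpow (by positivity) hb hx0
      _ = Real.exp (2 / n * x) := (Real.exp_mul _ _).symm
      _ ≤ Real.exp 2 := by
          rw [Real.exp_le_exp]
          rw [div_mul_eq_mul_div, div_le_iff₀ hn0]
          nlinarith
  calc (n : ℝ) ^ x * (1 + 2 / (n : ℝ)) ^ x ≤ (n : ℝ) ^ x * Real.exp 2 := by
        gcongr
    _ = Real.exp 2 * (n : ℝ) ^ x := by ring

/-- NEUTRAL SCALE: for `ε < 1/2` and `n` large, `e²(n+2)^{1+2ε} ≤ (n+2)(n+1)` — two fresh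
pointwise-fixed points raise the bump ratio by `(n+2)(n+1)`, far above the neutral `(n+2)^{1+2ε}`. -/
theorem neutral_threshold (ε : ℝ) :
    ∃ nS : ℕ, ∀ n ≥ nS, ε < 1 / 2 →
      Real.exp 2 * ((n : ℝ) + 2) ^ (1 + 2 * ε) ≤ ((n : ℝ) + 2) * ((n : ℝ) + 1) := by
  refine ⟨⌈(2 * Real.exp 2) ^ (1 - 2 * ε)⁻¹⌉₊, fun n hn hε2 => ?_⟩
  have hγ : 0 < 1 - 2 * ε := by linarith
  set y : ℝ := (n : ℝ) + 2 with hy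
  have hy2 : 2 ≤ y := by
    have : (0 : ℝ) ≤ n := Nat.cast_nonneg n
    rw [hy]; linarith
  have hy0 : 0 < y := by linarith
  -- y ≥ (2e²)^{1/(1-2ε)} hence y^{1-2ε} ≥ 2e²
  have hylow : (2 * Real.exp 2) ^ (1 - 2 * ε)⁻¹ ≤ y := by
    have h1 : ((⌈(2 * Real.exp 2) ^ (1 - 2 * ε)⁻¹⌉₊ : ℕ) : ℝ) ≤ n := by exact_mod_cast hn
    have h2 := Nat.le_ceil ((2 * Real.exp 2) ^ (1 - 2 * ε)⁻¹)
    rw [hy]; linarith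
  have hpow : 2 * Real.exp 2 ≤ y ^ (1 - 2 * ε) := by
    have h0 : 0 ≤ (2 * Real.exp 2) ^ (1 - 2 * ε)⁻¹ := by positivity
    have h1 := Real.rpow_le_rpow h0 hylow hγ.le
    rwa [Real.rpow_inv_rpow (by positivity) hγ.ne'] at h1
  -- y^{1+2ε} * y^{1-2ε} = y^2
  have hsplit : y ^ (1 + 2 * ε) * y ^ (1 - 2 * ε) = y ^ 2 := by
    rw [← Real.rpow_add hy0, show (1 + 2 * ε + (1 - 2 * ε)) = ((2 : ℕ) : ℝ) by norm_num,
      Real.rpow_natCast]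
  have hA : 0 ≤ y ^ (1 + 2 * ε) := by positivity
  -- e² y^{1+2ε} ≤ y^2 / 2 ≤ y (y - 1)
  have h1 : Real.exp 2 * y ^ (1 + 2 * ε) * (2 : ℝ) ≤ y ^ 2 := by
    calc Real.exp 2 * y ^ (1 + 2 * ε) * 2 = y ^ (1 + 2 * ε) * (2 * Real.exp 2) := by ring
      _ ≤ y ^ (1 + 2 * ε) * y ^ (1 - 2 * ε) := mul_le_mul_of_nonneg_left hpow hA
      _ = y ^ 2 := hsplit
  have h2 : y ^ 2 ≤ 2 * (y * (y - 1)) := by nlinarith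
  have h3 : y * (y - 1) = ((n : ℝ) + 2) * ((n : ℝ) + 1) := by rw [hy]; ring
  nlinarith

end Summit.MatrixMultiplication.MatrixMultiplication.Theorems.JuntaBranch.Planting
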